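import Summits.BirchSwinnertonDyer.BirchSwinnertonDyer.Theorems.BiquadraticEisensteinDescentHeegnerTwistCouplingInSupplySymbolicMonskyAuxLowerBoundTwins
import HarnessLib

set_option linter.dupNamespace false -- `Summit.BirchSwinnertonDyer.BirchSwinnertonDyer.Theorems.…` (summit = sub)
set_option autoImplicit false

/-!
# Crux `HeegnerTwistCouplingInSupply` (stmt-BirchSwinnertonDyer-21381) — the TWO-PRIME RECIPE, part 1: row expansions of Monsky's matrix of
# `dataK base aux pat` on a GENERAL vector, the `Q`-filtered sums, and the bookkeeping of a two-cell auxiliary list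

Route `BiquadraticEisensteinDescent` (cell `pub/bsd-wall`, width seat `bsd-wall-cm-bed-w3` g21; `--supports` 21381, helper). Tool file (1/3) of
the existence theorem «`s* = 2` ⇒ a pattern-free Heegner recipe with two auxiliary primes» (memo PATTERN-FREE-STRUCTURE-w3g21 §5b; part 3
`…SymbolicMonskyTwoPrime`).

* `mulVec_inl/inr_castAdd_expand`, `mulVec_inl/inr_natAdd_expand` — the four row families of `M(dataK base aux pat) z` for ANY `z` and any cell
  list (base part in the base's symbols, auxiliary part through the cell bits / the completed symbols), from w3 g20's row structure;
* `sum_filter_auxQ`, `auxQ_castAdd/natAdd` — the `Q`-filtered sums of the closure criterion are sums over the auxiliary indices;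
* two cells `[c₁, c₂]`: `sum_fin_two_cells`, `fin_two_cells_cases`, `sum_mutual_ref_eq_zero` (the reference mutual symbols vanish when
  `c₂ ≡ 1 (4)`), `bz_neg_natAdd_castAdd_two` (both auxiliary rows see `σ` when `c₁`'s bits are `m + σ`, `c₁ ≡ 3 (4)`, `c₂ ≡ 1 (4)`);
* `sum_neg_shift`, `sum_neg_add`, `sum_cell_mul_add` — difference-form Laplacian bookkeeping.

HONEST FRAMING: bookkeeping only; the crux (C⁺), its stubs and BSD untouched; nothing closed. THEOREMS ONLY.
Reference: [HeathBrown1994] appendix (Monsky), typescript pp. 39–41.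
-/

namespace Summit.BirchSwinnertonDyer.BirchSwinnertonDyer.Theorems.SymbolicMonsky

open Matrix

section TwoPrimeRows

open Matrix

variable {k : ℕ} (base : SymbData (k + 1)) (aux : List AuxCell) (pat : ℕ → ℕ → Bool)

/-! ### Row expansions of `M(dataK base aux pat)` on a GENERAL vector (any number of cells) -/

/-- Base row, half one, general vector. -/
theorem mulVec_inl_castAdd_expand (z : Fin (k + 1 + aux.length) ⊕ Fin (k + 1 + aux.length) → ZMod 2) (b : Fin (k + 1)) :
    ((dataK base aux pat).monskyOddS *ᵥ z) (Sum.inl (Fin.castAdd aux.length b)) =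
      (∑ b' : Fin (k + 1), bz (base.neg b b') * (z (Sum.inl (Fin.castAdd aux.length b')) + z (Sum.inl (Fin.castAdd aux.length b)))) +
      (∑ j : Fin aux.length, bz ((aux.getD j.val (0, 0)).2.testBit b.val) *
          (z (Sum.inl (Fin.natAdd (k + 1) j)) + z (Sum.inl (Fin.castAdd aux.length b)))) +
      bz (negTwo (base.cls b)) * (z (Sum.inl (Fin.castAdd aux.length b)) + z (Sum.inr (Fin.castAdd aux.length b))) := by
  rw [SymbData.monskyOddS_mulVec_inl, Fin.sum_univ_add]
  simp only [dataK_neg_castAdd_castAdd, dataK_neg_castAdd_natAdd, RealisesK.dataK_cls_castAdd]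

/-- Base row, half two, general vector. -/
theorem mulVec_inr_castAdd_expand (z : Fin (k + 1 + aux.length) ⊕ Fin (k + 1 + aux.length) → ZMod 2) (b : Fin (k + 1)) :
    ((dataK base aux pat).monskyOddS *ᵥ z) (Sum.inr (Fin.castAdd aux.length b)) =
      bz (negTwo (base.cls b)) * z (Sum.inl (Fin.castAdd aux.length b)) +
      ((∑ b' : Fin (k + 1), bz (base.neg b b') * (z (Sum.inr (Fin.castAdd aux.length b')) + z (Sum.inr (Fin.castAdd aux.length b)))) +
       (∑ j : Fin aux.length, bz ((aux.getD j.val (0, 0)).2.testBit b.val) *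
          (z (Sum.inr (Fin.natAdd (k + 1) j)) + z (Sum.inr (Fin.castAdd aux.length b))))) +
      bz (negNegTwo (base.cls b)) * z (Sum.inr (Fin.castAdd aux.length b)) := by
  rw [SymbData.monskyOddS_mulVec_inr, Fin.sum_univ_add]
  simp only [dataK_neg_castAdd_castAdd, dataK_neg_castAdd_natAdd, RealisesK.dataK_cls_castAdd]

/-- Auxiliary row, half one, general vector. -/
theorem mulVec_inl_natAdd_expand (z : Fin (k + 1 + aux.length) ⊕ Fin (k + 1 + aux.length) → ZMod 2) (j : Fin aux.length) :
    ((dataK base aux pat).monskyOddS *ᵥ z) (Sum.inl (Fin.natAdd (k + 1) j)) =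
      (∑ b : Fin (k + 1), bz ((dataK base aux pat).neg (Fin.natAdd (k + 1) j) (Fin.castAdd aux.length b)) *
          (z (Sum.inl (Fin.castAdd aux.length b)) + z (Sum.inl (Fin.natAdd (k + 1) j)))) +
      (∑ j' : Fin aux.length, bz ((dataK base aux pat).neg (Fin.natAdd (k + 1) j) (Fin.natAdd (k + 1) j')) *
          (z (Sum.inl (Fin.natAdd (k + 1) j')) + z (Sum.inl (Fin.natAdd (k + 1) j)))) +
      bz (negTwo (aux.getD j.val (0, 0)).1) * (z (Sum.inl (Fin.natAdd (k + 1) j)) + z (Sum.inr (Fin.natAdd (k + 1) j))) := by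
  rw [SymbData.monskyOddS_mulVec_inl, Fin.sum_univ_add]
  simp only [RealisesK.dataK_cls_natAdd]

/-- Auxiliary row, half two, general vector. -/
theorem mulVec_inr_natAdd_expand (z : Fin (k + 1 + aux.length) ⊕ Fin (k + 1 + aux.length) → ZMod 2) (j : Fin aux.length) :
    ((dataK base aux pat).monskyOddS *ᵥ z) (Sum.inr (Fin.natAdd (k + 1) j)) =
      bz (negTwo (aux.getD j.val (0, 0)).1) * z (Sum.inl (Fin.natAdd (k + 1) j)) +
      ((∑ b : Fin (k + 1), bz ((dataK base aux pat).neg (Fin.natAdd (k + 1) j) (Fin.castAdd aux.length b)) *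
          (z (Sum.inr (Fin.castAdd aux.length b)) + z (Sum.inr (Fin.natAdd (k + 1) j)))) +
       (∑ j' : Fin aux.length, bz ((dataK base aux pat).neg (Fin.natAdd (k + 1) j) (Fin.natAdd (k + 1) j')) *
          (z (Sum.inr (Fin.natAdd (k + 1) j')) + z (Sum.inr (Fin.natAdd (k + 1) j))))) +
      bz (negNegTwo (aux.getD j.val (0, 0)).1) * z (Sum.inr (Fin.natAdd (k + 1) j)) := by
  rw [SymbData.monskyOddS_mulVec_inr, Fin.sum_univ_add]
  simp only [RealisesK.dataK_cls_natAdd]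

/-- The `Q`-filtered sum over `auxQ` is the sum over the auxiliary indices. -/
theorem sum_filter_auxQ (F : Fin (k + 1 + aux.length) → ZMod 2) :
    (∑ i ∈ Finset.univ.filter (fun i => auxQ k aux.length i = true), F i) = ∑ j : Fin aux.length, F (Fin.natAdd (k + 1) j) := by
  classical
  rw [Finset.sum_filter, Fin.sum_univ_add]
  have h1 : ∀ b : Fin (k + 1), (if auxQ k aux.length (Fin.castAdd aux.length b) = true then F (Fin.castAdd aux.length b) else 0) = 0 := by
    intro b
    have hb := b.isLt
    have : ¬ (auxQ k aux.length (Fin.castAdd aux.length b) = true) := by simp [auxQ]; omega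
    rw [if_neg this]
  have h2 : ∀ j : Fin aux.length, (if auxQ k aux.length (Fin.natAdd (k + 1) j) = true then F (Fin.natAdd (k + 1) j) else 0) =
      F (Fin.natAdd (k + 1) j) := by
    intro j
    have : auxQ k aux.length (Fin.natAdd (k + 1) j) = true := by simp [auxQ]
    rw [if_pos this]
  simp only [h1, h2, Finset.sum_const_zero, zero_add]

/-- `auxQ` is false on base indices and true on auxiliary ones. -/
theorem auxQ_castAdd (b : Fin (k + 1)) : auxQ k aux.length (Fin.castAdd aux.length b) = false := by
  have hb := b.isLt
  simp [auxQ]; omega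

/-- `auxQ` is true on auxiliary indices. -/
theorem auxQ_natAdd (j : Fin aux.length) : auxQ k aux.length (Fin.natAdd (k + 1) j) = true := by simp [auxQ]

end TwoPrimeRows

section TwoPrime

open Matrix

variable {k : ℕ} (base : SymbData (k + 1)) (c₁ c₂ : AuxCell)

/-- Sums over the index type of a two-element cell list. -/
theorem sum_fin_two_cells (F : Fin [c₁, c₂].length → ZMod 2) :
    (∑ j, F j) = F ⟨0, by simp⟩ + F ⟨1, by simp⟩ := by
  show (∑ j : Fin 2, F j) = _
  rw [Fin.sum_univ_two]
  rfl

/-- Every index of `Fin [c₁,c₂].length` is `0` or `1`. -/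
theorem fin_two_cells_cases (j : Fin [c₁, c₂].length) : j = ⟨0, by simp⟩ ∨ j = ⟨1, by simp⟩ := by
  rcases j with ⟨v, hv⟩
  have : v < 2 := hv
  interval_cases v
  · exact Or.inl rfl
  · exact Or.inr rfl

/-- The reference mutual symbols of a two-cell list whose second cell is `≡ 1 (mod 4)` all vanish in `𝔽₂` (against the weight `z j' + z j`). -/
theorem sum_mutual_ref_eq_zero (hm2 : negNegOne c₂.1 = false) (g : Fin [c₁, c₂].length → ZMod 2) (j : Fin [c₁, c₂].length) :
    (∑ j' : Fin [c₁, c₂].length, bz ((dataK base [c₁, c₂] (fun _ _ => false)).neg (Fin.natAdd (k + 1) j) (Fin.natAdd (k + 1) j')) *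
      (g j' + g j)) = 0 := by
  rw [sum_fin_two_cells]
  rcases fin_two_cells_cases c₁ c₂ j with rfl | rfl
  · rw [zmod_two_add_self, mul_zero, zero_add]
    have : (dataK base [c₁, c₂] (fun _ _ => false)).neg (Fin.natAdd (k + 1) ⟨0, by simp⟩) (Fin.natAdd (k + 1) ⟨1, by simp⟩) = false := by
      unfold SymbData.neg
      rw [if_pos (by rw [Fin.lt_def]; simp), RealisesK.dataK_up_natAdd_natAdd]
    rw [this]; simp [bz]
  · rw [zmod_two_add_self, mul_zero, add_zero]
    have : (dataK base [c₁, c₂] (fun _ _ => false)).neg (Fin.natAdd (k + 1) ⟨1, by simp⟩) (Fin.natAdd (k + 1) ⟨0, by simp⟩) = false := by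
      unfold SymbData.neg
      rw [if_neg (by rw [Fin.lt_def]; simp), RealisesK.dataK_up_natAdd_natAdd, RealisesK.dataK_cls_natAdd,
        RealisesK.dataK_cls_natAdd]
      simp [hm2]
    rw [this]; simp [bz]

/-- The completed symbols aux × base of the two-cell recipe: both rows see `σ = c₂`'s bits when `c₁`'s bits are `m + σ`,
`c₁ ≡ 3 (4)`, `c₂ ≡ 1 (4)`. -/
theorem bz_neg_natAdd_castAdd_two (hσ : ∀ b : Fin (k + 1), c₁.2.testBit b.val = xor (negNegOne (base.cls b)) (c₂.2.testBit b.val))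
    (hm1 : negNegOne c₁.1 = true) (hm2 : negNegOne c₂.1 = false) (pat : ℕ → ℕ → Bool) (j : Fin [c₁, c₂].length) (b : Fin (k + 1)) :
    bz ((dataK base [c₁, c₂] pat).neg (Fin.natAdd (k + 1) j) (Fin.castAdd [c₁, c₂].length b)) = bz (c₂.2.testBit b.val) := by
  rw [dataK_neg_natAdd_castAdd]
  rcases fin_two_cells_cases c₁ c₂ j with rfl | rfl
  · simp only [List.getD_cons_zero, hσ b, hm1, Bool.true_and]
    cases negNegOne (base.cls b) <;> cases c₂.2.testBit b.val <;> rfl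
  · have : [c₁, c₂].getD (1 : ℕ) (0, 0) = c₂ := rfl
    simp only [this, hm2, Bool.false_and, Bool.xor_false]

end TwoPrime

section TwoPrimeSmall

variable {k : ℕ} (base : SymbData (k + 1)) (c₁ c₂ : AuxCell)


open Matrix

variable {k : ℕ} (base : SymbData (k + 1)) (c₁ c₂ : AuxCell)

/-- Shift invariance of the difference-form Laplacian row. -/
theorem sum_neg_shift (i : Fin (k + 1)) (p : Fin (k + 1) → ZMod 2) (c : ZMod 2) :
    (∑ j, bz (base.neg i j) * ((p j + c) + (p i + c))) = ∑ j, bz (base.neg i j) * (p j + p i) :=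
  Finset.sum_congr rfl fun j _ => by
    rw [show p j + c + (p i + c) = (p j + p i) + (c + c) from by ring, zmod_two_add_self, add_zero]

/-- Additivity of the difference-form Laplacian row. -/
theorem sum_neg_add (i : Fin (k + 1)) (p q : Fin (k + 1) → ZMod 2) :
    (∑ j, bz (base.neg i j) * ((p j + q j) + (p i + q i))) =
      (∑ j, bz (base.neg i j) * (p j + p i)) + ∑ j, bz (base.neg i j) * (q j + q i) := by
  rw [← Finset.sum_add_distrib]; exact Finset.sum_congr rfl fun j _ => by ring

/-- `∑_b σ_b (p_b + c) = ∑_b σ_b p_b + (∑_b σ_b)·c`. -/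
theorem sum_cell_mul_add (p : Fin (k + 1) → ZMod 2) (c : ZMod 2) :
    (∑ b : Fin (k + 1), bz (c₂.2.testBit b.val) * (p b + c)) =
      (∑ b : Fin (k + 1), bz (c₂.2.testBit b.val) * p b) + (∑ b : Fin (k + 1), bz (c₂.2.testBit b.val)) * c := by
  rw [Finset.sum_mul, ← Finset.sum_add_distrib]; exact Finset.sum_congr rfl fun b _ => by ring

end TwoPrimeSmall

end Summit.BirchSwinnertonDyer.BirchSwinnertonDyer.Theorems.SymbolicMonsky
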